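import Summits.HodgeConjecture.CorCM.IrreducibleOddWeightsBlockHellyCMFields
import Summits.HodgeConjecture.CorCM.IrreducibleOddWeightsProductSpanBlocks
import HarnessLib

/-!
# Across the blocks of a partition, Hodge gluing and the exterior-product property are decided `q + 1` blocks at a
# time (`q ≥ max_c dim Hg(X_c)`; PAIRS of blocks under an abelian Galois closure), and the first exceptional mixed
# class across blocks lives on a MINIMAL set of blocks `C₀` with `|C₀| ≤ dim MT(X_c)` for every block `c ∈ C₀`

COR-CM (cell `pub-hodgecm2`, binder seat `b16` gen 61, count-neutral claim BLOCKS ARE MEMBERS, file H3 — CM fields and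
their realisations; theorems only, no definition, no named fact, no `sorry`).  NEW as stated, hence under `Summits/`.
HONEST FRAMING: unconditional structure theorems on Hodge classes of products of CM abelian varieties, and reductions
between instances of the Hodge conjecture (the Hodge conjecture inside the blocks is a HYPOTHESIS of the gluing
statements); `HC_CM` is neither used nor asserted.

Realisations `A_i ⊨ (K_i; Φ_i)` (`i ∈ I` finite), a partition `κ : I ↠ C` into blocks `X_c = ∏_{κ i = c} A_i` (nothing
assumed inside a block), `T` block additive = `cmFamilyRank Φ|_{κ ∈ T} + |T| = Σ_{c ∈ T} cmFamilyRank Φ|_{κ = c} + 1`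
(`Hg(∏_{c ∈ T} X_c) = ∏_{c ∈ T} Hg(X_c)`).  Gen 60 proved: block additivity (of `C`) + the Hodge conjecture for the
products of copies inside each block ⟹ the Hodge conjecture for every product of copies (G5), and block additivity ⟺
the Hodge classes of `(∏_j A_{π₁ j}) × (∏_j A_{π₂ j})` are exterior products whenever `π₁`, `π₂` meet disjoint sets of
blocks (G8).  File H2 (`IrreducibleOddWeightsBlockHellyCMFields`) decides block additivity on few blocks.  Hence:

* §1 **`hodgeConjectureFor_biproduct_of_forall_card_le_fiber_of_cmFamilyRank_le`** — `dim MT(X_c) ≤ q + 1` for all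
  blocks, every non-empty set of at most `q + 1` blocks block additive, HC for products of copies inside each block ⟹ HC
  for every product of copies `⨁_j A_{π j}`; `…_of_finrank_le` (`dim X_c ≤ q`); `…_index_succ` (`[Gal(L/ℚ) : A] + 1`
  blocks); **`…_two_of_comm`** (`Gal(L/ℚ)` ABELIAN: `Hg(X_c × X_{c'}) = Hg(X_c) × Hg(X_{c'})` for all PAIRS of blocks + HC
  inside the blocks ⟹ HC for all products of copies).
* §2 **`cmFamilyRank_fiber_add_card_eq_iff_forall_card_le_hodgeClassesProductSpan`** — `dim MT(X_c) ≤ q + 1` for all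
  blocks ⟹ `Hg(∏_i A_i) = ∏_c Hg(X_c)` IFF the Hodge classes of `(∏_j A_{π₁ j}) × (∏_j A_{π₂ j})` are exterior products
  for all `π₁`, `π₂` meeting disjoint sets of blocks which TOGETHER number at most `q + 1`.
* §3 **`exists_minimal_not_hodgeClassesProductSpan_of_cmFamilyRank_fiber_add_card_ne`** — if `Hg(∏_i A_i) ⊊ ∏_c Hg(X_c)`
  there are a MINIMAL block-non-additive set of blocks `C₀` (every non-empty proper subset block additive), with
  `|C₀| ≤ cmFamilyRank Φ|_{κ = c} = dim MT(X_c)` for EVERY `c ∈ C₀`, a block `c₀ ∈ C₀` and slot maps `π₁` inside `c₀`,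
  `π₂` inside `C₀ ∖ {c₀}` with `¬ HodgeClassesProductSpan (⨁ A∘π₁) (⨁ A∘π₂)`: the first exceptional mixed class ACROSS
  blocks needs every block it involves to have `dim Hg ≥ |C₀| − 1`; `exists_card_le_not_hodgeClassesProductSpan_fiber_…`
  (`≤ q + 1` blocks), `exists_pair_not_hodgeClassesProductSpan_fiber_…` (a block with `dim Hg ≤ 1` involved ⟹ TWO blocks).

With `κ = id` these are gen 60's G4 / G7 / G10.

## References

* [MoonenZarhin1999LowDim] B. Moonen, Yu. Zarhin, *Hodge classes on abelian varieties of low dimension*, Math. Ann.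
  315 (1999), §3 (3.1), Remark (3.9).
* [Gordon1999HodgeAVSurvey] B. B. Gordon, *A survey of the Hodge conjecture for abelian varieties*, §3 Theorem (Imai,
  Murty) with proof; 7.5–7.7.
* [Mai1989] L. Mai, *Lower bounds for the ranks of CM types*, J. Number Theory 32 (1989), §2 Prop. 1 (proof).
* [vanGeemen1994HodgeAV] B. van Geemen, *An introduction to the Hodge conjecture for abelian varieties*, LNM 1594
  (1994), §3.5–3.7 Lemma 3.7.
* [Shimura1998] G. Shimura, *Abelian Varieties with Complex Multiplication and Modular Functions* (1998), §8.1, §32.10.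
-/

set_option autoImplicit false

noncomputable section

open scoped BigOperators

open CategoryTheory CategoryTheory.Limits NumberField

namespace Summit.HodgeConjecture.CorCM

open Literature.NumberTheory.ComplexMultiplication
open Literature.AlgebraicGeometry.Motives (AbelianVariety CMType)
open Literature.AlgebraicGeometry.Motives.AbelianVariety
open Literature.AlgebraicGeometry.HodgeTheory
open Literature.AlgebraicGeometry.ComplexMultiplication (IsCMTypeRealisation)
open Literature.AlgebraicGeometry.Pohlmann1968

variable {I : Type} [Fintype I] {K : I → Type} [∀ i, Field (K i)] [∀ i, NumberField (K i)] [∀ i, IsCMField (K i)]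
  {C : Type} [Fintype C] [DecidableEq C] {L : Type} [Field L] [NumberField L] [Normal ℚ L]
  {Φ : ∀ i, CMType (K i)} {A : I → AbelianVariety ℂ} {ιA : ∀ i, 𝓞 (K i) →+* End (A i)}
  {θ : ∀ i, K i →+* Module.End ℂ (complexBetti (A i).X 1)}

/-! ### §1 Hodge gluing across blocks is decided on few blocks -/

/-- **HODGE GLUING ACROSS BLOCKS, `q + 1` BLOCKS AT A TIME.**  Realisations `A_i ⊨ (K_i; Φ_i)`, a partition `κ : I ↠ C`
with `dim MT(X_c) = cmFamilyRank Φ|_{κ = c} ≤ q + 1` for every block.  IF every non-empty set of at most `q + 1` blocks is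
block additive (`Hg(∏_{c ∈ T} X_c) = ∏_{c ∈ T} Hg(X_c)`) and the Hodge conjecture holds for every product of copies of
members of each single block, THEN the Hodge conjecture holds for every product of copies `⨁_j A_{π j}`.
[cite: MoonenZarhin1999LowDim, §3 (3.1)] [cite: Mai1989, §2 Prop. 1 (proof)]
[cite: Gordon1999HodgeAVSurvey, §3 Theorem (Imai, Murty) with proof, 7.5–7.7] [cite: vanGeemen1994HodgeAV, §3.5–3.7 Lemma 3.7 (p. 236)] -/
theorem hodgeConjectureFor_biproduct_of_forall_card_le_fiber_of_cmFamilyRank_le (κ : I → C)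
    (hκ : Function.Surjective κ) (q : ℕ)
    (hq : ∀ c, CMAlgebra.cmFamilyRank (fun i : {i // κ i = c} => Φ i.1) ≤ q + 1)
    (hT : ∀ T : Finset C, T.Nonempty → T.card ≤ q + 1 →
      CMAlgebra.cmFamilyRank (fun i : {i // κ i ∈ T} => Φ i.1) + T.card =
        (∑ c ∈ T, CMAlgebra.cmFamilyRank fun i : {i // κ i = c} => Φ i.1) + 1)
    (hA : ∀ i, IsCMTypeRealisation (Φ i) (A i) (ιA i) (θ i))
    (hHC : ∀ (c : C) (J : Type) [Fintype J] [Nonempty J] (π : J → {i // κ i = c}),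
      HodgeConjectureFor (⨁ fun j => A (π j).1).dim (⨁ fun j => A (π j).1).X)
    {J : Type} [Fintype J] [Nonempty J] (π : J → I) :
    HodgeConjectureFor (⨁ fun j => A (π j)).dim (⨁ fun j => A (π j)).X := by
  obtain ⟨j₀⟩ := ‹Nonempty J›
  haveI : Nonempty I := ⟨π j₀⟩
  exact hodgeConjectureFor_biproduct_of_cmFamilyRank_fiber_add_card_eq κ hκ
    ((cmFamilyRank_fiber_add_card_eq_iff_forall_card_le_of_cmFamilyRank_le Φ κ hκ q hq).2 hT) hA hHC π

/-- **Blocks of dimension `≤ q` glue `q + 1` at a time**: `Σ_{κ i = c} [K_i : ℚ] ≤ 2q` for every block (`dim X_c ≤ q`),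
every non-empty set of at most `q + 1` blocks block additive, HC inside the blocks ⟹ HC for every product of copies.
[cite: Shimura1998, §32.10 Prop.] [cite: MoonenZarhin1999LowDim, §3 (3.1)] [cite: vanGeemen1994HodgeAV, §3.5–3.7 Lemma 3.7 (p. 236)] -/
theorem hodgeConjectureFor_biproduct_of_forall_card_le_fiber_of_finrank_le (κ : I → C)
    (hκ : Function.Surjective κ) (q : ℕ) (hq : ∀ c, (∑ i : {i // κ i = c}, Module.finrank ℚ (K i.1)) ≤ 2 * q)
    (hT : ∀ T : Finset C, T.Nonempty → T.card ≤ q + 1 →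
      CMAlgebra.cmFamilyRank (fun i : {i // κ i ∈ T} => Φ i.1) + T.card =
        (∑ c ∈ T, CMAlgebra.cmFamilyRank fun i : {i // κ i = c} => Φ i.1) + 1)
    (hA : ∀ i, IsCMTypeRealisation (Φ i) (A i) (ιA i) (θ i))
    (hHC : ∀ (c : C) (J : Type) [Fintype J] [Nonempty J] (π : J → {i // κ i = c}),
      HodgeConjectureFor (⨁ fun j => A (π j).1).dim (⨁ fun j => A (π j).1).X)
    {J : Type} [Fintype J] [Nonempty J] (π : J → I) :
    HodgeConjectureFor (⨁ fun j => A (π j)).dim (⨁ fun j => A (π j)).X := by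
  obtain ⟨j₀⟩ := ‹Nonempty J›
  haveI : Nonempty I := ⟨π j₀⟩
  exact hodgeConjectureFor_biproduct_of_cmFamilyRank_fiber_add_card_eq κ hκ
    ((cmFamilyRank_fiber_add_card_eq_iff_forall_card_le_of_finrank_le Φ κ hκ q hq).2 hT) hA hHC π

/-- **Index form: `[Gal(L/ℚ) : A] + 1` blocks at a time** (`K_i ↪ L` Galois, `A ≤ Gal(L/ℚ)` with pairwise commuting
elements). [cite: Serre1977, §3.1 Cor. to Thm. 9] [cite: MoonenZarhin1999LowDim, §3 (3.1)] [cite: vanGeemen1994HodgeAV, §3.5–3.7 Lemma 3.7 (p. 236)] -/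
theorem hodgeConjectureFor_biproduct_of_forall_card_le_index_succ_fiber (ι : L →+* ℂ) (e : ∀ i, K i →+* L)
    (κ : I → C) (hκ : Function.Surjective κ) (A' : Subgroup (L ≃ₐ[ℚ] L)) (hA' : ∀ a ∈ A', ∀ b ∈ A', a * b = b * a)
    (hT : ∀ T : Finset C, T.Nonempty → T.card ≤ A'.index + 1 →
      CMAlgebra.cmFamilyRank (fun i : {i // κ i ∈ T} => Φ i.1) + T.card =
        (∑ c ∈ T, CMAlgebra.cmFamilyRank fun i : {i // κ i = c} => Φ i.1) + 1)
    (hA : ∀ i, IsCMTypeRealisation (Φ i) (A i) (ιA i) (θ i))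
    (hHC : ∀ (c : C) (J : Type) [Fintype J] [Nonempty J] (π : J → {i // κ i = c}),
      HodgeConjectureFor (⨁ fun j => A (π j).1).dim (⨁ fun j => A (π j).1).X)
    {J : Type} [Fintype J] [Nonempty J] (π : J → I) :
    HodgeConjectureFor (⨁ fun j => A (π j)).dim (⨁ fun j => A (π j)).X := by
  obtain ⟨j₀⟩ := ‹Nonempty J›
  haveI : Nonempty I := ⟨π j₀⟩
  exact hodgeConjectureFor_biproduct_of_cmFamilyRank_fiber_add_card_eq κ hκ
    ((cmFamilyRank_fiber_add_card_eq_iff_forall_card_le_index_succ ι e Φ κ hκ A' hA').2 hT) hA hHC π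

/-- **`Gal(L/ℚ)` ABELIAN: PAIRS OF BLOCKS GLUE.**  All `K_i` inside an abelian Galois number field `L` (e.g. cyclotomic
CM fields), ARBITRARY CM types and blocks: if `Hg(X_c × X_{c'}) = Hg(X_c) × Hg(X_{c'})` for all pairs of blocks and the
Hodge conjecture holds for the products of copies inside each block, then it holds for every product of copies of all the
`A_i`.  (The torus `Hg` admits no Goursat–Ribet lemma in general; commuting Galois actions are the case where pairs DO
suffice.) [cite: Gordon1999HodgeAVSurvey, §3 Theorem (Imai, Murty) with proof, 7.5–7.7]
[cite: MoonenZarhin1999LowDim, §3 (3.1) and Remark (3.9)] [cite: vanGeemen1994HodgeAV, §3.5–3.7 Lemma 3.7 (p. 236)] -/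
theorem hodgeConjectureFor_biproduct_of_forall_card_le_two_fiber_of_comm (ι : L →+* ℂ) (e : ∀ i, K i →+* L)
    (κ : I → C) (hκ : Function.Surjective κ) (hG : ∀ a b : L ≃ₐ[ℚ] L, a * b = b * a)
    (hT : ∀ T : Finset C, T.Nonempty → T.card ≤ 2 →
      CMAlgebra.cmFamilyRank (fun i : {i // κ i ∈ T} => Φ i.1) + T.card =
        (∑ c ∈ T, CMAlgebra.cmFamilyRank fun i : {i // κ i = c} => Φ i.1) + 1)
    (hA : ∀ i, IsCMTypeRealisation (Φ i) (A i) (ιA i) (θ i))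
    (hHC : ∀ (c : C) (J : Type) [Fintype J] [Nonempty J] (π : J → {i // κ i = c}),
      HodgeConjectureFor (⨁ fun j => A (π j).1).dim (⨁ fun j => A (π j).1).X)
    {J : Type} [Fintype J] [Nonempty J] (π : J → I) :
    HodgeConjectureFor (⨁ fun j => A (π j)).dim (⨁ fun j => A (π j)).X := by
  obtain ⟨j₀⟩ := ‹Nonempty J›
  haveI : Nonempty I := ⟨π j₀⟩
  exact hodgeConjectureFor_biproduct_of_cmFamilyRank_fiber_add_card_eq κ hκ
    ((cmFamilyRank_fiber_add_card_eq_iff_forall_card_le_two_of_comm ι e Φ κ hκ hG).2 hT) hA hHC π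

/-! ### §2 Sub-families over a set of blocks: their block additivity versus exterior products -/

omit [Fintype C] in
/-- **Block additivity of a set of blocks `T` ⟺ exterior products across disjoint blocks INSIDE `T`.**  For a non-empty
set of blocks `T`: `Hg(∏_{c ∈ T} X_c) = ∏_{c ∈ T} Hg(X_c)` iff for all slot maps `π₁`, `π₂` (non-empty finite sources)
landing in blocks of `T` and meeting disjoint sets of blocks, `HodgeClassesProductSpan (⨁ A∘π₁) (⨁ A∘π₂)` (G8's block
equivalence for the sub-family `(A_i)_{κ i ∈ T}` partitioned by `κ`). [cite: MoonenZarhin1999LowDim, §3 (3.1)]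
[cite: Gordon1999HodgeAVSurvey, 7.5–7.7] -/
theorem cmFamilyRank_fiber_mem_add_card_eq_iff_forall_hodgeClassesProductSpan (κ : I → C)
    (hκ : Function.Surjective κ) (hA : ∀ i, IsCMTypeRealisation (Φ i) (A i) (ιA i) (θ i)) (T : Finset C)
    (hT : T.Nonempty) :
    CMAlgebra.cmFamilyRank (fun i : {i // κ i ∈ T} => Φ i.1) + T.card =
        (∑ c ∈ T, CMAlgebra.cmFamilyRank fun i : {i // κ i = c} => Φ i.1) + 1 ↔
      ∀ (N₁ N₂ : ℕ) [NeZero N₁] [NeZero N₂] (π₁ : Fin N₁ → I) (π₂ : Fin N₂ → I),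
        (∀ j, κ (π₁ j) ∈ T) → (∀ j, κ (π₂ j) ∈ T) → (∀ j₁ j₂, κ (π₁ j₁) ≠ κ (π₂ j₂)) →
          HodgeClassesProductSpan (⨁ fun j => A (π₁ j)) (⨁ fun j => A (π₂ j)) := by
  classical
  obtain ⟨c₁, hc₁⟩ := hT
  obtain ⟨i₁, rfl⟩ := hκ c₁
  haveI : Nonempty {i // κ i ∈ T} := ⟨⟨i₁, hc₁⟩⟩
  -- the sub-family over `T`, partitioned by `κ`
  set κT : {i // κ i ∈ T} → {c // c ∈ T} := fun i => ⟨κ i.1, i.2⟩ with hκT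
  have hκTs : Function.Surjective κT := by
    rintro ⟨c, hc⟩
    obtain ⟨i, rfl⟩ := hκ c
    exact ⟨⟨i, hc⟩, rfl⟩
  have key := cmFamilyRank_fiber_add_card_eq_iff_forall_hodgeClassesProductSpan (Φ := fun i : {i // κ i ∈ T} => Φ i.1)
    (A := fun i : {i // κ i ∈ T} => A i.1) κT hκTs fun i => hA i.1
  have hf : ∀ c : {c // c ∈ T},
      CMAlgebra.cmFamilyRank (fun i : {i : {i // κ i ∈ T} // κT i = c} => Φ i.1.1) =
        CMAlgebra.cmFamilyRank fun i : {i // κ i = c.1} => Φ i.1 := fun c => cmFamilyRank_fiber_mem_eq Φ κ T c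
  have hsum : ∑ c : {c // c ∈ T}, CMAlgebra.cmFamilyRank (fun i : {i // κ i = c.1} => Φ i.1) =
      ∑ c ∈ T, CMAlgebra.cmFamilyRank fun i : {i // κ i = c} => Φ i.1 :=
    Finset.sum_coe_sort T fun c => CMAlgebra.cmFamilyRank fun i : {i // κ i = c} => Φ i.1
  rw [Finset.sum_congr rfl fun c _ => hf c, Fintype.card_coe, hsum] at key
  rw [key]
  constructor
  · intro H N₁ N₂ _ _ π₁ π₂ h₁ h₂ hdisj
    exact H N₁ N₂ (fun j => ⟨π₁ j, h₁ j⟩) (fun j => ⟨π₂ j, h₂ j⟩) fun j₁ j₂ h =>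
      hdisj j₁ j₂ (congrArg Subtype.val h)
  · intro H N₁ N₂ _ _ π₁ π₂ hdisj
    exact H N₁ N₂ (fun j => (π₁ j).1) (fun j => (π₂ j).1) (fun j => (π₁ j).2) (fun j => (π₂ j).2)
      fun j₁ j₂ h => hdisj j₁ j₂ (Subtype.ext h)

/-- **`Hg(∏_i A_i) = ∏_c Hg(X_c)` IFF EXTERIOR PRODUCTS ACROSS DISJOINT SETS OF BLOCKS NUMBERING AT MOST `q + 1` TOGETHER**
(`dim MT(X_c) ≤ q + 1` for every block): the `n`-ary Moonen–Zarhin equivalence over blocks (G8) needs the product-span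
property only for `π₁`, `π₂` meeting at most `q + 1` blocks in all. [cite: MoonenZarhin1999LowDim, §3 (3.1)]
[cite: Mai1989, §2 Prop. 1 (proof)] [cite: Gordon1999HodgeAVSurvey, 7.5–7.7] -/
theorem cmFamilyRank_fiber_add_card_eq_iff_forall_card_le_hodgeClassesProductSpan [Nonempty I] (κ : I → C)
    (hκ : Function.Surjective κ) (q : ℕ)
    (hq : ∀ c, CMAlgebra.cmFamilyRank (fun i : {i // κ i = c} => Φ i.1) ≤ q + 1)
    (hA : ∀ i, IsCMTypeRealisation (Φ i) (A i) (ιA i) (θ i)) :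
    CMAlgebra.cmFamilyRank Φ + Fintype.card C = (∑ c, CMAlgebra.cmFamilyRank fun i : {i // κ i = c} => Φ i.1) + 1 ↔
      ∀ (N₁ N₂ : ℕ) [NeZero N₁] [NeZero N₂] (π₁ : Fin N₁ → I) (π₂ : Fin N₂ → I),
        (∀ j₁ j₂, κ (π₁ j₁) ≠ κ (π₂ j₂)) →
        ((Finset.univ.image fun j => κ (π₁ j)) ∪ Finset.univ.image fun j => κ (π₂ j)).card ≤ q + 1 →
          HodgeClassesProductSpan (⨁ fun j => A (π₁ j)) (⨁ fun j => A (π₂ j)) := by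
  classical
  refine ⟨fun hadd N₁ N₂ _ _ π₁ π₂ hdisj _ =>
    hodgeClassesProductSpan_biproduct_of_cmFamilyRank_fiber_add_card_eq κ hκ hadd hA π₁ π₂ hdisj, fun H => ?_⟩
  refine (cmFamilyRank_fiber_add_card_eq_iff_forall_card_le_of_cmFamilyRank_le Φ κ hκ q hq).2 fun T hT hTc => ?_
  refine (cmFamilyRank_fiber_mem_add_card_eq_iff_forall_hodgeClassesProductSpan κ hκ hA T hT).2
    fun N₁ N₂ _ _ π₁ π₂ h₁ h₂ hdisj => H N₁ N₂ π₁ π₂ hdisj ?_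
  refine le_trans (Finset.card_le_card ?_) hTc
  intro c hc
  rcases Finset.mem_union.1 hc with hc | hc
  · obtain ⟨j, -, rfl⟩ := Finset.mem_image.1 hc
    exact h₁ j
  · obtain ⟨j, -, rfl⟩ := Finset.mem_image.1 hc
    exact h₂ j

/-! ### §3 Where the first exceptional mixed class across blocks lives -/

/-- **THE FIRST EXCEPTIONAL MIXED CLASS ACROSS BLOCKS LIVES ON A MINIMAL SET OF BLOCKS, WHICH IS SMALL.**  Realisations
`A_i ⊨ (K_i; Φ_i)`, a partition `κ : I ↠ C` with `Hg(∏_i A_i) ⊊ ∏_c Hg(X_c)` (block additivity FAILS).  Then there are a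
set of blocks `C₀` and `c₀ ∈ C₀` such that: `C₀` is not block additive, every non-empty proper subset of `C₀` is,
`|C₀| ≤ cmFamilyRank Φ|_{κ = c} = dim MT(X_c)` for EVERY `c ∈ C₀`, and for some `N₁, N₂ ≥ 1`, `π₁ : Fin N₁ → I` inside the
block `c₀` and `π₂ : Fin N₂ → I` inside the blocks of `C₀ ∖ {c₀}`, the product `(∏_j A_{π₁ j}) × (∏_j A_{π₂ j})` carries a
rational Hodge class which is NOT a `ℂ`-combination of exterior products of Hodge classes of the two factors.
[cite: MoonenZarhin1999LowDim, §3 (3.1)] [cite: Mai1989, §2 Prop. 1 (proof)] [cite: Gordon1999HodgeAVSurvey, 7.5–7.7] -/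
theorem exists_minimal_not_hodgeClassesProductSpan_of_cmFamilyRank_fiber_add_card_ne [Nonempty I] (κ : I → C)
    (hκ : Function.Surjective κ) (hA : ∀ i, IsCMTypeRealisation (Φ i) (A i) (ιA i) (θ i))
    (hne : CMAlgebra.cmFamilyRank Φ + Fintype.card C ≠
      (∑ c, CMAlgebra.cmFamilyRank fun i : {i // κ i = c} => Φ i.1) + 1) :
    ∃ (C₀ : Finset C) (c₀ : C), c₀ ∈ C₀ ∧
      CMAlgebra.cmFamilyRank (fun i : {i // κ i ∈ C₀} => Φ i.1) + C₀.card ≠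
        (∑ c ∈ C₀, CMAlgebra.cmFamilyRank fun i : {i // κ i = c} => Φ i.1) + 1 ∧
      (∀ T : Finset C, T ⊂ C₀ → T.Nonempty →
        CMAlgebra.cmFamilyRank (fun i : {i // κ i ∈ T} => Φ i.1) + T.card =
          (∑ c ∈ T, CMAlgebra.cmFamilyRank fun i : {i // κ i = c} => Φ i.1) + 1) ∧
      (∀ c ∈ C₀, C₀.card ≤ CMAlgebra.cmFamilyRank fun i : {i // κ i = c} => Φ i.1) ∧
      ∃ (N₁ N₂ : ℕ) (_ : NeZero N₁) (_ : NeZero N₂) (π₁ : Fin N₁ → I) (π₂ : Fin N₂ → I),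
        (∀ j, κ (π₁ j) = c₀) ∧ (∀ j, κ (π₂ j) ∈ C₀.erase c₀) ∧
          ¬ HodgeClassesProductSpan (⨁ fun j => A (π₁ j)) (⨁ fun j => A (π₂ j)) := by
  classical
  obtain ⟨C₀, hC₀ne, hC₀, hmin, hcard⟩ := exists_minimal_cmFamilyRank_fiber_add_card_ne Φ κ hκ hne
  -- the block equivalence for the sub-family over `C₀` fails, inside `C₀`
  have hfail : ¬ ∀ (N₁ N₂ : ℕ) [NeZero N₁] [NeZero N₂] (π₁ : Fin N₁ → I) (π₂ : Fin N₂ → I),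
      (∀ j, κ (π₁ j) ∈ C₀) → (∀ j, κ (π₂ j) ∈ C₀) → (∀ j₁ j₂, κ (π₁ j₁) ≠ κ (π₂ j₂)) →
        HodgeClassesProductSpan (⨁ fun j => A (π₁ j)) (⨁ fun j => A (π₂ j)) :=
    fun H => hC₀ ((cmFamilyRank_fiber_mem_add_card_eq_iff_forall_hodgeClassesProductSpan κ hκ hA C₀ hC₀ne).2 H)
  -- hence G8's witness for the sub-family over `C₀`
  obtain ⟨c₁, hc₁⟩ := hC₀ne
  obtain ⟨i₁, rfl⟩ := hκ c₁
  haveI : Nonempty {i // κ i ∈ C₀} := ⟨⟨i₁, hc₁⟩⟩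
  set κ₀ : {i // κ i ∈ C₀} → {c // c ∈ C₀} := fun i => ⟨κ i.1, i.2⟩ with hκ₀
  have hκ₀s : Function.Surjective κ₀ := by
    rintro ⟨c, hc⟩
    obtain ⟨i, rfl⟩ := hκ c
    exact ⟨⟨i, hc⟩, rfl⟩
  have hne₀ : CMAlgebra.cmFamilyRank (fun i : {i // κ i ∈ C₀} => Φ i.1) + Fintype.card {c // c ∈ C₀} ≠
      (∑ c : {c // c ∈ C₀}, CMAlgebra.cmFamilyRank
        fun i : {i : {i // κ i ∈ C₀} // κ₀ i = c} => Φ i.1.1) + 1 := by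
    have hf : ∀ c : {c // c ∈ C₀},
        CMAlgebra.cmFamilyRank (fun i : {i : {i // κ i ∈ C₀} // κ₀ i = c} => Φ i.1.1) =
          CMAlgebra.cmFamilyRank fun i : {i // κ i = c.1} => Φ i.1 := fun c => cmFamilyRank_fiber_mem_eq Φ κ C₀ c
    have hsum : ∑ c : {c // c ∈ C₀}, CMAlgebra.cmFamilyRank (fun i : {i // κ i = c.1} => Φ i.1) =
        ∑ c ∈ C₀, CMAlgebra.cmFamilyRank fun i : {i // κ i = c} => Φ i.1 :=
      Finset.sum_coe_sort C₀ fun c => CMAlgebra.cmFamilyRank fun i : {i // κ i = c} => Φ i.1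
    rw [Finset.sum_congr rfl fun c _ => hf c, Fintype.card_coe, hsum]
    exact hC₀
  obtain ⟨c₀, N₁, N₂, hN₁, hN₂, π₁, π₂, h₁, h₂, hnot⟩ :=
    exists_not_hodgeClassesProductSpan_of_cmFamilyRank_fiber_add_card_ne (Φ := fun i : {i // κ i ∈ C₀} => Φ i.1)
      (A := fun i : {i // κ i ∈ C₀} => A i.1) κ₀ hκ₀s (fun i => hA i.1) hne₀
  refine ⟨C₀, c₀.1, c₀.2, hC₀, hmin, hcard, N₁, N₂, hN₁, hN₂, fun j => (π₁ j).1, fun j => (π₂ j).1,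
    fun j => congrArg Subtype.val (h₁ j), fun j => Finset.mem_erase.2 ⟨fun h => h₂ j (Subtype.ext h), (π₂ j).2⟩,
    hnot⟩

/-- **If `dim MT(X_c) ≤ q + 1` for every block, the first exceptional mixed class across blocks involves at most `q + 1`
blocks** (one block against at most `q` others). [cite: MoonenZarhin1999LowDim, §3 (3.1)] [cite: Mai1989, §2 Prop. 1 (proof)] -/
theorem exists_card_le_not_hodgeClassesProductSpan_fiber_of_cmFamilyRank_le [Nonempty I] (κ : I → C)
    (hκ : Function.Surjective κ) (hA : ∀ i, IsCMTypeRealisation (Φ i) (A i) (ιA i) (θ i)) (q : ℕ)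
    (hq : ∀ c, CMAlgebra.cmFamilyRank (fun i : {i // κ i = c} => Φ i.1) ≤ q + 1)
    (hne : CMAlgebra.cmFamilyRank Φ + Fintype.card C ≠
      (∑ c, CMAlgebra.cmFamilyRank fun i : {i // κ i = c} => Φ i.1) + 1) :
    ∃ (C₀ : Finset C) (c₀ : C), c₀ ∈ C₀ ∧ C₀.card ≤ q + 1 ∧
      ∃ (N₁ N₂ : ℕ) (_ : NeZero N₁) (_ : NeZero N₂) (π₁ : Fin N₁ → I) (π₂ : Fin N₂ → I),
        (∀ j, κ (π₁ j) = c₀) ∧ (∀ j, κ (π₂ j) ∈ C₀.erase c₀) ∧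
          ¬ HodgeClassesProductSpan (⨁ fun j => A (π₁ j)) (⨁ fun j => A (π₂ j)) := by
  obtain ⟨C₀, c₀, hc₀, -, -, hcard, N₁, N₂, hN₁, hN₂, π₁, π₂, h₁, h₂, hnot⟩ :=
    exists_minimal_not_hodgeClassesProductSpan_of_cmFamilyRank_fiber_add_card_ne κ hκ hA hne
  exact ⟨C₀, c₀, hc₀, (hcard c₀ hc₀).trans (hq c₀), N₁, N₂, hN₁, hN₂, π₁, π₂, h₁, h₂, hnot⟩

/-- **If every block has `dim Hg(X_c) ≤ 1` (`cmFamilyRank ≤ 2`: e.g. every block is isogenous to a power of a CM elliptic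
curve), the first exceptional mixed class across blocks lives on TWO blocks**: `(∏ A_{π₁ j}) × (∏ A_{π₂ j})` with `π₁`
inside one block and `π₂` inside ONE other block. [cite: MoonenZarhin1999LowDim, §3 (3.1)] [cite: Gordon1999HodgeAVSurvey, §3 and 7.7] -/
theorem exists_pair_not_hodgeClassesProductSpan_fiber_of_cmFamilyRank_le_two [Nonempty I] (κ : I → C)
    (hκ : Function.Surjective κ) (hA : ∀ i, IsCMTypeRealisation (Φ i) (A i) (ιA i) (θ i))
    (hq : ∀ c, CMAlgebra.cmFamilyRank (fun i : {i // κ i = c} => Φ i.1) ≤ 2)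
    (hne : CMAlgebra.cmFamilyRank Φ + Fintype.card C ≠
      (∑ c, CMAlgebra.cmFamilyRank fun i : {i // κ i = c} => Φ i.1) + 1) :
    ∃ (c₀ c₁ : C), c₀ ≠ c₁ ∧
      ∃ (N₁ N₂ : ℕ) (_ : NeZero N₁) (_ : NeZero N₂) (π₁ : Fin N₁ → I) (π₂ : Fin N₂ → I),
        (∀ j, κ (π₁ j) = c₀) ∧ (∀ j, κ (π₂ j) = c₁) ∧
          ¬ HodgeClassesProductSpan (⨁ fun j => A (π₁ j)) (⨁ fun j => A (π₂ j)) := by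
  classical
  obtain ⟨C₀, c₀, hc₀, hC₀, N₁, N₂, hN₁, hN₂, π₁, π₂, h₁, h₂, hnot⟩ :=
    exists_card_le_not_hodgeClassesProductSpan_fiber_of_cmFamilyRank_le κ hκ hA 1 hq hne
  -- `C₀ ∖ {c₀}` has at most one element, and `π₂` lands in it
  haveI := hN₂
  have hcard : (C₀.erase c₀).card ≤ 1 := by
    rw [Finset.card_erase_of_mem hc₀]
    omega
  have h0 : κ (π₂ 0) ∈ C₀.erase c₀ := h₂ 0
  refine ⟨c₀, κ (π₂ 0), fun h => (Finset.mem_erase.1 h0).1 h.symm, N₁, N₂, hN₁, hN₂, π₁, π₂, h₁, fun j => ?_, hnot⟩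
  exact Finset.card_le_one.1 hcard _ (h₂ j) _ h0

end Summit.HodgeConjecture.CorCM

end
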